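import Literature.Computability.Cryptography.InfrastructureWalkFP
import Literature.Computability.Cryptography.HallgrenCandidateCheck
import HarnessLib

/-!
# Checking a candidate period in polynomial time: the integer form of `GiantStepCycle.Passes`

Topic `Computability/Cryptography`; joins `HallgrenCandidateCheck.lean` (the tolerant test `Passes`
on the abstract infrastructure: walk to `x − Δ`, probe two baby steps for the unit ideal) to
`InfrastructureWalkFP.lean` (the integer walk `finalI`, `babyI` on codes, `cast_finalI`, `cast_babyI`,
`codeFP_finalI`, `codeFP_babyI`). For a candidate integer `sc` (the period `S = NR` in grid units),
the target is `x = sc/N` and the shift `Δ = δ₀/N`; the probe states are integer states `(a, D̂)`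
meaning `(a, D̂/2ᵖ)`, so the distance test `|D̂/2ᵖ − sc/N| ≤ 2δ₀/N` is the integer comparison
`|N D̂ − sc 2ᵖ| ≤ 2 δ₀ 2ᵖ`. Theorem-and-definition file, no named facts.

* `probeI`, `checkAtI`, **`passesI`** (a `Bool`: `N/8 ≤ sc` and some shift `j ≤ 2` checks);
* **`passesI_eq`** — `passesI` decides `N/8 ≤ sc ∧ GiantStepCycle.Passes (sc/N) (δ₀/N)` for any
  cycle `C` presenting the rational walk data `O.toWalkData d`;
* **`codeFP_passesI`** — it is computed in the typed polynomial-time algebra `CodeFP` under an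
  `FPSpec` (labels compared through their injective codes).

## References

* R. Jozsa, arXiv:quant-ph/0302134 (2003), §9 Thm. 5, §10 step (c). [Jozsa2003]
* S. Arora, B. Barak, *Computational Complexity*, CUP 2009, §1.3. [AroraBarak2009]
-/

noncomputable section

open scoped Classical

namespace Literature.Computability.Cryptography

namespace IntWalkOps

open Literature.Computability.Complexity Literature.Computability.Complexity.CodeFP Polynomial WalkData

variable {δ ι : Type} (O : IntWalkOps δ ι) (d : δ)

/-! ### The integer test -/

/-- The probed integer state: `j` integer baby steps after the integer walk to `(sc − δ₀)/N`. [cite: Jozsa2003, §10 (c)] -/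
def probeI (N δ₀ s₀ T B : ℕ) (sc : ℤ) (j : ℕ) : StI ι := (O.babyI d)^[j] (O.finalI d (sc - δ₀) N s₀ T B)

/-- The check at shift `j`, in integers: unit label and `|N D̂ − sc 2ᵖ| ≤ 2 δ₀ 2ᵖ`. [cite: Jozsa2003, §10 (c)] -/
def checkAtI (N δ₀ s₀ T B : ℕ) (sc : ℤ) (j : ℕ) : Prop :=
  (O.probeI d N δ₀ s₀ T B sc j).1 = O.unit d ∧
    |(N : ℤ) * (O.probeI d N δ₀ s₀ T B sc j).2 - sc * 2 ^ O.prec d| ≤ 2 * δ₀ * 2 ^ O.prec d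

/-- **The integer test of a candidate**: `N/8 ≤ sc` and some shift `j ≤ 2` checks. [cite: Jozsa2003, §10 (c)] -/
def passesI (N δ₀ s₀ T B : ℕ) (sc : ℤ) : Bool :=
  decide ((N : ℤ) / 8 ≤ sc ∧ (O.checkAtI d N δ₀ s₀ T B sc 0 ∨ O.checkAtI d N δ₀ s₀ T B sc 1 ∨ O.checkAtI d N δ₀ s₀ T B sc 2))

/-! ### Correspondence with the rational test -/

/-- Iterated integer baby steps correspond. [folklore] -/
theorem cast_iterate_babyI (s : StI ι) (j : ℕ) :
    O.cast d ((O.babyI d)^[j] s) = ((O.toWalkData d).babyStep)^[j] (O.cast d s) := by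
  induction j generalizing s with
  | zero => rfl
  | succ j ih => rw [Function.iterate_succ_apply, Function.iterate_succ_apply, ← O.cast_babyI, ih]

variable {O d}

/-- The probes correspond, for a cycle presenting the rational walk data. [folklore] -/
theorem cast_probeI (C : GiantStepCycle ι) (hC : C.toWalkData = O.toWalkData d) {N : ℕ} (hN : 0 < N)
    (δ₀ s₀ T B : ℕ) (sc : ℤ) (j : ℕ) :
    O.cast d (O.probeI d N δ₀ s₀ T B sc j) = C.probe ((sc : ℚ) / N) ((δ₀ : ℚ) / N) s₀ T B j := by
  unfold probeI GiantStepCycle.probe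
  rw [O.cast_iterate_babyI, O.cast_finalI d hN, hC]
  congr 2
  push_cast
  ring

/-- **The integer check is the rational check.** [folklore] -/
theorem checkAtI_iff (C : GiantStepCycle ι) (hC : C.toWalkData = O.toWalkData d) {N : ℕ} (hN : 0 < N)
    (δ₀ s₀ T B : ℕ) (sc : ℤ) (j : ℕ) :
    O.checkAtI d N δ₀ s₀ T B sc j ↔ C.CheckAt ((sc : ℚ) / N) ((δ₀ : ℚ) / N) s₀ T B j := by
  have hc := cast_probeI C hC hN δ₀ s₀ T B sc j
  have hunit : C.unit = O.unit d := by
    have := congrArg WalkData.unit hC; simpa [toWalkData] using this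
  unfold checkAtI GiantStepCycle.CheckAt
  rw [← hc]
  simp only [cast, hunit]
  apply and_congr Iff.rfl
  -- `|D̂/2ᵖ − sc/N| ≤ 2 δ₀/N ↔ |N D̂ − sc 2ᵖ| ≤ 2 δ₀ 2ᵖ`
  have hN' : (0 : ℚ) < N := by exact_mod_cast hN
  have hp : (0 : ℚ) < 2 ^ O.prec d := by positivity
  have key : ((O.probeI d N δ₀ s₀ T B sc j).2 : ℚ) / 2 ^ O.prec d - (sc : ℚ) / N =
      (((N : ℤ) * (O.probeI d N δ₀ s₀ T B sc j).2 - sc * 2 ^ O.prec d : ℤ) : ℚ) / ((N : ℚ) * 2 ^ O.prec d) := by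
    rw [div_sub_div _ _ (ne_of_gt hp) (ne_of_gt hN')]
    push_cast; ring
  rw [key, abs_div, abs_of_pos (show (0 : ℚ) < (N : ℚ) * 2 ^ O.prec d by positivity), div_le_iff₀ (by positivity)]
  rw [show (2 : ℚ) * ((δ₀ : ℚ) / N) * ((N : ℚ) * 2 ^ O.prec d) = ((2 * δ₀ * 2 ^ O.prec d : ℤ) : ℚ) by
    push_cast; field_simp]
  rw [← Int.cast_abs]
  exact Int.cast_le.symm

/-- **The integer test decides the rational test** (with the size threshold `N/8 ≤ sc`). [cite: Jozsa2003, §10 (c)] -/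
theorem passesI_eq (C : GiantStepCycle ι) (hC : C.toWalkData = O.toWalkData d) {N : ℕ} (hN : 0 < N)
    (δ₀ s₀ T B : ℕ) (sc : ℤ) :
    O.passesI d N δ₀ s₀ T B sc = decide ((N : ℤ) / 8 ≤ sc ∧ C.Passes ((sc : ℚ) / N) ((δ₀ : ℚ) / N) s₀ T B) := by
  unfold passesI GiantStepCycle.Passes
  simp only [checkAtI_iff C hC hN]
  congr 1
  apply propext
  apply and_congr Iff.rfl
  constructor
  · rintro (h | h | h)
    · exact ⟨0, by norm_num, h⟩
    · exact ⟨1, by norm_num, h⟩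
    · exact ⟨2, le_rfl, h⟩
  · rintro ⟨j, hj, h⟩
    interval_cases j
    · exact Or.inl h
    · exact Or.inr (Or.inl h)
    · exact Or.inr (Or.inr h)

/-! ### The test on codes -/

section FP

variable {eδ : δ → List Bool} {eι : ι → List Bool} (S : O.FPSpec eδ eι)

/-- The context `(d, N, δ₀, 1^{s₀}, 1^T, 1^B, sc)`. [folklore] -/
abbrev cctxE (eδ : δ → List Bool) : δ × ℕ × ℕ × ℕ × ℕ × ℕ × ℤ → List Bool :=
  pairE eδ (pairE natE (pairE natE (pairE unE (pairE unE (pairE unE intE)))))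

include S

/-- **The probe on codes.** [cite: Jozsa2003, §9 Thm. 5] -/
theorem codeFP_probeI (j : ℕ) :
    CodeFP (cctxE eδ) (stE eι) (fun c => O.probeI c.1 c.2.1 c.2.2.1 c.2.2.2.1 c.2.2.2.2.1 c.2.2.2.2.2.1 c.2.2.2.2.2.2 j) := by
  have hd : CodeFP (cctxE eδ) eδ (fun c => c.1) := fst _ _
  have hN : CodeFP (cctxE eδ) natE (fun c => c.2.1) := (snd _ _).fst'
  have hδ : CodeFP (cctxE eδ) natE (fun c => c.2.2.1) := (snd _ _).snd'.fst'
  have hs : CodeFP (cctxE eδ) unE (fun c => c.2.2.2.1) := (snd _ _).snd'.snd'.fst'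
  have hT : CodeFP (cctxE eδ) unE (fun c => c.2.2.2.2.1) := (snd _ _).snd'.snd'.snd'.fst'
  have hB : CodeFP (cctxE eδ) unE (fun c => c.2.2.2.2.2.1) := (snd _ _).snd'.snd'.snd'.snd'.fst'
  have hsc : CodeFP (cctxE eδ) intE (fun c => c.2.2.2.2.2.2) := (snd _ _).snd'.snd'.snd'.snd'.snd'
  have hv : CodeFP (cctxE eδ) intE (fun c => c.2.2.2.2.2.2 - (c.2.2.1 : ℤ)) := (intSub.comp (hsc.pair (intOfNat.comp hδ)) :)
  have hfin : CodeFP (cctxE eδ) (stE eι)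
      (fun c => O.finalI c.1 (c.2.2.2.2.2.2 - (c.2.2.1 : ℤ)) c.2.1 c.2.2.2.1 c.2.2.2.2.1 c.2.2.2.2.2.1) :=
    ((S.codeFP_finalI).comp (hd.pair (hN.pair (hv.pair (hs.pair (hT.pair hB))))) :)
  induction j with
  | zero => exact hfin.congr fun c => rfl
  | succ j ih =>
    exact ((S.codeFP_babyI).comp (hd.pair ih)).congr fun c => by
      simp only [probeI, Function.iterate_succ_apply']

/-- **The check on codes** (labels compared through their injective codes). [folklore] -/
theorem codeFP_checkAtI (he : Function.Injective eι) (j : ℕ) :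
    CodeFP (cctxE eδ) bitE
      (fun c => decide (O.checkAtI c.1 c.2.1 c.2.2.1 c.2.2.2.1 c.2.2.2.2.1 c.2.2.2.2.2.1 c.2.2.2.2.2.2 j)) := by
  have hd : CodeFP (cctxE eδ) eδ (fun c => c.1) := fst _ _
  have hN : CodeFP (cctxE eδ) intE (fun c => (c.2.1 : ℤ)) := (intOfNat.comp (snd _ _).fst' :)
  have hδ : CodeFP (cctxE eδ) intE (fun c => (c.2.2.1 : ℤ)) := (intOfNat.comp (snd _ _).snd'.fst' :)
  have hsc : CodeFP (cctxE eδ) intE (fun c => c.2.2.2.2.2.2) := (snd _ _).snd'.snd'.snd'.snd'.snd'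
  have hpr := codeFP_probeI S j
  have hpow : CodeFP (cctxE eδ) intE (fun c => (2 : ℤ) ^ O.prec c.1) := ((S.codeFP_twoPowPrec).comp hd :)
  have hlab : CodeFP (cctxE eδ) bitE (fun c =>
      decide ((O.probeI c.1 c.2.1 c.2.2.1 c.2.2.2.1 c.2.2.2.2.1 c.2.2.2.2.2.1 c.2.2.2.2.2.2 j).1 = O.unit c.1)) :=
    ((CodeFP.eq he).comp (hpr.fst'.pair (S.h_unit.comp hd)) :)
  have hdist : CodeFP (cctxE eδ) bitE (fun c =>
      decide (|(c.2.1 : ℤ) * (O.probeI c.1 c.2.1 c.2.2.1 c.2.2.2.1 c.2.2.2.2.1 c.2.2.2.2.2.1 c.2.2.2.2.2.2 j).2 -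
        c.2.2.2.2.2.2 * 2 ^ O.prec c.1| ≤ 2 * (c.2.2.1 : ℤ) * 2 ^ O.prec c.1)) :=
    (intLe.comp ((intAbs.comp (intSub.comp ((intMul.comp (hN.pair hpr.snd')).pair (intMul.comp (hsc.pair hpow))))).pair
      (intMul.comp ((intMul.comp ((const _ (2 : ℤ)).pair hδ)).pair hpow))) :)
  refine ((hlab.and hdist).congr fun c => ?_)
  unfold checkAtI
  by_cases h1 : (O.probeI c.1 c.2.1 c.2.2.1 c.2.2.2.1 c.2.2.2.2.1 c.2.2.2.2.2.1 c.2.2.2.2.2.2 j).1 = O.unit c.1 <;>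
    by_cases h2 : |(c.2.1 : ℤ) * (O.probeI c.1 c.2.1 c.2.2.1 c.2.2.2.1 c.2.2.2.2.1 c.2.2.2.2.2.1 c.2.2.2.2.2.2 j).2 -
        c.2.2.2.2.2.2 * 2 ^ O.prec c.1| ≤ 2 * (c.2.2.1 : ℤ) * 2 ^ O.prec c.1 <;> simp [h1, h2]

/-- **The test on codes.** [cite: Jozsa2003, §10 (c)] [cite: AroraBarak2009, §1.3] -/
theorem codeFP_passesI (he : Function.Injective eι) :
    CodeFP (cctxE eδ) bitE
      (fun c => O.passesI c.1 c.2.1 c.2.2.1 c.2.2.2.1 c.2.2.2.2.1 c.2.2.2.2.2.1 c.2.2.2.2.2.2) := by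
  have hN : CodeFP (cctxE eδ) intE (fun c => (c.2.1 : ℤ)) := (intOfNat.comp (snd _ _).fst' :)
  have hsc : CodeFP (cctxE eδ) intE (fun c => c.2.2.2.2.2.2) := (snd _ _).snd'.snd'.snd'.snd'.snd'
  have hthr : CodeFP (cctxE eδ) bitE (fun c => decide ((c.2.1 : ℤ) / 8 ≤ c.2.2.2.2.2.2)) :=
    (intLe.comp ((intEDiv.comp (hN.pair (const _ (8 : ℤ)))).pair hsc) :)
  have h0 := codeFP_checkAtI S he 0
  have h1 := codeFP_checkAtI S he 1
  have h2 := codeFP_checkAtI S he 2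
  refine ((hthr.and (h0.or (h1.or h2))).congr fun c => ?_)
  unfold passesI
  by_cases ht : (c.2.1 : ℤ) / 8 ≤ c.2.2.2.2.2.2 <;>
    by_cases a0 : O.checkAtI c.1 c.2.1 c.2.2.1 c.2.2.2.1 c.2.2.2.2.1 c.2.2.2.2.2.1 c.2.2.2.2.2.2 0 <;>
    by_cases a1 : O.checkAtI c.1 c.2.1 c.2.2.1 c.2.2.2.1 c.2.2.2.2.1 c.2.2.2.2.2.1 c.2.2.2.2.2.2 1 <;>
    by_cases a2 : O.checkAtI c.1 c.2.1 c.2.2.1 c.2.2.2.1 c.2.2.2.2.1 c.2.2.2.2.2.1 c.2.2.2.2.2.2 2 <;>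
    simp [ht, a0, a1, a2]

end FP

end IntWalkOps

end Literature.Computability.Cryptography

end
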